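import Mathlib
import HarnessLib
import Literature.NumberTheory.LFunctions.ZetaScrew
import Summits.RiemannHypothesis.RiemannHypothesis.Theorems.ZetaStringKernelWindows

/-!
# Route `IntegerScrew` — `S_M ⪰ 0` on every BALANCED vector of every window of ratio `e²`
# (the Weil rung `a = 1` re-indexed to Suzuki's integer screw matrices; PIVOT-LAW §16; RH-FREE)

The tree certifies Weil positivity on the window `[-1, 1]`
(`WeilFormatCData.A1.weilPositivityOn_one`), and the SCREW ↔ WEIL dictionary of Suzuki2023 Prop. 3.1
(`Ψ'' = W`; tree: `ZetaStringKernelOfWeilOn`, `ZetaStringKernelWindows`) turns it into the RH-free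
statement that Suzuki's screw function `Ψ = zetaScrew` is conditionally negative definite on every
zero-sum configuration of diameter `< 2`
(`KernelOfWeilOn.sum_sum_mul_zetaScrew_nonpos_of_diam_lt_two`).  On the nodes `log m` of the route
`IntegerScrew` this reads: for all `N < M` with `log M − log(N+1) < 2`, i.e. `M < e²(N+1)`
(`e² = 7.389…`), the screw Gram matrix `S_M = [G(log m, log m')]` (`G(t,u) = Ψ(t) + Ψ(u) − Ψ(t−u)`,
`zetaScrewKernel`) is non-negative on every BALANCED real vector supported on the window `(N, M]`:

* `screwForm_balanced_nonneg_of_log_lt_two` — families of nodes `mᵢ ∈ (N, M]` (`Fin`-indexed),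
  `∑ xᵢ = 0` ⟹ `0 ≤ ∑ᵢⱼ G(log mᵢ, log mⱼ) xᵢ xⱼ`, under `log M − log(N+1) < 2`;
* `screwForm_balanced_nonneg_of_le_seven_mul` — the same under the integer condition `M ≤ 7(N+1)`;
* `screwWindow_nonneg_of_le_seven_mul` — the same in the shape of
  `IntegerScrewScrewPolyFloorWindowFloor.screwWindowFloor` (sums over `Finset.Ioc N M`, `x : ℕ → ℝ`):
  `M ≤ 7(N+1)`, `∑_{N<m≤M} x_m = 0` ⟹ `0 ≤ ∑_{N<m,m'≤M} G(log m, log m') x_m x_{m'}`.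

So the RH-free window floor of `IntegerScrewScrewPolyFloorWindowFloor` (ratio `1 + 1/250`, with the
margin `(1 − log 2)/(4M)`) extends — as plain non-negativity — to every window of ratio `7` (indeed
`e²`), for EVERY `M`: RH cannot fail through a balanced vector living on the top window `(M/7, M]`.
For the whole matrix (all vectors, or windows reaching the node `1`) non-negativity for all `M` is RH
(`IntegerScrewPivotCriterion`).  WHAT THIS IS NOT: not progress toward RH — it is the Weil column's
certified depth `a = 1` seen in the screw column's coordinates; nothing here bears on the truth of RH.

References: M. Suzuki, J. Lond. Math. Soc. (2) 108 (2023) 1448–1487 = arXiv:2206.03682, (1.4)–(1.5),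
Prop. 3.1 [Suzuki2023]; A. Weil (1952); H. Yoshida (1992).
-/

noncomputable section

-- D-0017: `Summit.<S>.<S>.…` is the designed namespace of a single-problem summit.
set_option linter.dupNamespace false

namespace Summit.RiemannHypothesis.RiemannHypothesis.Theorems.IntegerScrew

open Literature.NumberTheory.LFunctions Finset
open Summit.RiemannHypothesis.RiemannHypothesis.Theorems.KernelOfWeilOn
  (sum_sum_mul_zetaScrew_nonpos_of_diam_lt_two)

/-- For zero-sum real weights the one-point terms of `G(t,u) = Ψ(t) + Ψ(u) − Ψ(t−u)` cancel:
`∑ᵢⱼ G(tᵢ, tⱼ) xᵢ xⱼ = −∑ᵢⱼ xᵢ xⱼ Ψ(tᵢ − tⱼ)` (`Fin`-indexed form of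
`sum_kernel_eq_neg_sum_of_sum_eq_zero`). [folklore] -/
theorem sum_sum_zetaScrewKernel_eq_neg_of_sum_eq_zero {n : ℕ} (t x : Fin n → ℝ)
    (hx : ∑ i, x i = 0) :
    ∑ i, ∑ j, zetaScrewKernel (t i) (t j) * (x i * x j) =
      -∑ i, ∑ j, x i * x j * zetaScrew (t i - t j) := by
  have h1 : ∑ i, ∑ j, zetaScrew (t i) * (x i * x j) = 0 := by
    have : ∀ i, ∑ j, zetaScrew (t i) * (x i * x j) = zetaScrew (t i) * x i * ∑ j, x j := by
      intro i
      rw [Finset.mul_sum]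
      exact Finset.sum_congr rfl fun j _ => by ring
    simp_rw [this, hx, mul_zero, Finset.sum_const_zero]
  have h2 : ∑ i, ∑ j, zetaScrew (t j) * (x i * x j) = 0 := by
    rw [Finset.sum_comm]
    have : ∀ j, ∑ i, zetaScrew (t j) * (x i * x j) = zetaScrew (t j) * x j * ∑ i, x i := by
      intro j
      rw [Finset.mul_sum]
      exact Finset.sum_congr rfl fun i _ => by ring
    simp_rw [this, hx, mul_zero, Finset.sum_const_zero]
  have h3 : ∑ i, ∑ j, zetaScrewKernel (t i) (t j) * (x i * x j) =
      ∑ i, ∑ j, zetaScrew (t i) * (x i * x j) + ∑ i, ∑ j, zetaScrew (t j) * (x i * x j)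
        - ∑ i, ∑ j, x i * x j * zetaScrew (t i - t j) := by
    rw [← Finset.sum_add_distrib, ← Finset.sum_sub_distrib]
    refine Finset.sum_congr rfl fun i _ => ?_
    rw [← Finset.sum_add_distrib, ← Finset.sum_sub_distrib]
    refine Finset.sum_congr rfl fun j _ => ?_
    rw [zetaScrewKernel_def]
    ring
  rw [h3, h1, h2]
  ring

/-- **`S_M ⪰ 0` on balanced vectors of every window of log-length `< 2`** (RH-FREE): if
`log M − log(N+1) < 2` then for every family of nodes `mᵢ ∈ (N, M]` and real weights with
`∑ xᵢ = 0`, `0 ≤ ∑ᵢⱼ G(log mᵢ, log mⱼ) xᵢ xⱼ`.  The nodes have pairwise log-distance `< 2`, so this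
is `KernelOfWeilOn.sum_sum_mul_zetaScrew_nonpos_of_diam_lt_two` (the Weil rung `a = 1`) after the
zero-sum cancellation of the one-point terms. [cite: Suzuki2023, (1.4)–(1.5) and Prop 3.1] -/
theorem screwForm_balanced_nonneg_of_log_lt_two {N M : ℕ}
    (hNM : Real.log M - Real.log ((N : ℝ) + 1) < 2) {n : ℕ} (m : Fin n → ℕ)
    (hm : ∀ i, N < m i ∧ m i ≤ M) (x : Fin n → ℝ) (hx : ∑ i, x i = 0) :
    0 ≤ ∑ i, ∑ j, zetaScrewKernel (Real.log (m i)) (Real.log (m j)) * (x i * x j) := by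
  have hN1 : (0 : ℝ) < (N : ℝ) + 1 := by positivity
  have hdiam : ∀ i j, Real.log (m i) - Real.log (m j) < 2 := by
    intro i j
    have hi2 : (m i : ℝ) ≤ M := by exact_mod_cast (hm i).2
    have hj1 : (N : ℝ) + 1 ≤ m j := by exact_mod_cast Nat.succ_le_of_lt (hm j).1
    have hipos : (0 : ℝ) < m i := hN1.trans_le (by exact_mod_cast Nat.succ_le_of_lt (hm i).1)
    have hli : Real.log (m i) ≤ Real.log M := Real.log_le_log hipos hi2
    have hlj : Real.log ((N : ℝ) + 1) ≤ Real.log (m j) := Real.log_le_log hN1 hj1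
    linarith
  have h := sum_sum_mul_zetaScrew_nonpos_of_diam_lt_two (fun i => Real.log (m i)) x hdiam hx
  rw [sum_sum_zetaScrewKernel_eq_neg_of_sum_eq_zero _ x hx]
  linarith

/-- **`S_M ⪰ 0` on balanced vectors of every window of ratio `7`** (RH-FREE): if `M ≤ 7(N+1)`,
every family of nodes `mᵢ ∈ (N, M]` and real weights with `∑ xᵢ = 0` has
`0 ≤ ∑ᵢⱼ G(log mᵢ, log mⱼ) xᵢ xⱼ` — e.g. every balanced vector supported on `(M/7, M]`, for EVERY
`M`. [cite: Suzuki2023, (1.4)–(1.5) and Prop 3.1] -/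
theorem screwForm_balanced_nonneg_of_le_seven_mul {N M : ℕ} (hNM : M ≤ 7 * (N + 1)) {n : ℕ}
    (m : Fin n → ℕ) (hm : ∀ i, N < m i ∧ m i ≤ M) (x : Fin n → ℝ) (hx : ∑ i, x i = 0) :
    0 ≤ ∑ i, ∑ j, zetaScrewKernel (Real.log (m i)) (Real.log (m j)) * (x i * x j) := by
  rcases isEmpty_or_nonempty (Fin n) with hn | ⟨⟨i₀⟩⟩
  · simp
  refine screwForm_balanced_nonneg_of_log_lt_two ?_ m hm x hx
  have hN1 : (0 : ℝ) < (N : ℝ) + 1 := by positivity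
  have hMpos : (0 : ℝ) < M :=
    hN1.trans_le (by exact_mod_cast (Nat.succ_le_of_lt (hm i₀).1).trans (hm i₀).2)
  have hM7 : (M : ℝ) ≤ 7 * ((N : ℝ) + 1) := by exact_mod_cast hNM
  have h1 : Real.log M ≤ Real.log (7 * ((N : ℝ) + 1)) := Real.log_le_log hMpos hM7
  rw [Real.log_mul (by norm_num) hN1.ne'] at h1
  -- `log 7 < 2` (`7 < e²`, from `exp 1 > 2.7182818283`)
  have hlog7 : Real.log 7 < 2 := by
    rw [Real.log_lt_iff_lt_exp (by norm_num)]
    have h := Real.exp_one_gt_d9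
    have h2 : Real.exp 2 = Real.exp 1 * Real.exp 1 := by rw [← Real.exp_add]; norm_num
    rw [h2]
    nlinarith
  linarith

/-- **The window floor of `IntegerScrewScrewPolyFloorWindowFloor` extended to ratio `7`, as plain
non-negativity** (RH-FREE): for all `N, M` with `M ≤ 7(N+1)` and all real `x` balanced on the window,
`∑_{N<m≤M} x_m = 0`, one has `0 ≤ ∑_{N<m,m'≤M} G(log m, log m') x_m x_{m'}` — the screw Gram matrix
`S_M` is non-negative on every balanced vector supported on `(N, M]`. [cite: Suzuki2023, (1.4)–(1.5) and Prop 3.1] -/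
theorem screwWindow_nonneg_of_le_seven_mul (N M : ℕ) (hNM : M ≤ 7 * (N + 1)) (x : ℕ → ℝ)
    (hx : ∑ m ∈ Ioc N M, x m = 0) :
    0 ≤ ∑ m ∈ Ioc N M, ∑ m' ∈ Ioc N M,
      zetaScrewKernel (Real.log m) (Real.log m') * (x m * x m') := by
  -- re-index the window by `Fin`
  set s : Finset ℕ := Ioc N M with hs
  set e := s.equivFin with he
  have hmem : ∀ i : Fin s.card, N < (e.symm i : ℕ) ∧ (e.symm i : ℕ) ≤ M := by
    intro i
    have h : ((e.symm i : ℕ)) ∈ Ioc N M := (e.symm i).2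
    exact Finset.mem_Ioc.1 h
  have hsum1 : ∀ f : ℕ → ℝ, ∑ m ∈ s, f m = ∑ i : Fin s.card, f (e.symm i) := by
    intro f
    rw [← Finset.sum_coe_sort s f]
    exact (Fintype.sum_equiv e.symm (fun i => f (e.symm i)) (fun m => f m) fun i => rfl).symm
  have hx' : ∑ i : Fin s.card, x (e.symm i) = 0 := by rw [← hsum1]; exact hx
  have key := screwForm_balanced_nonneg_of_le_seven_mul hNM (fun i => (e.symm i : ℕ)) hmem
    (fun i => x (e.symm i)) hx'
  rw [hsum1]
  simp_rw [hsum1]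
  exact key

end Summit.RiemannHypothesis.RiemannHypothesis.Theorems.IntegerScrew
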